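import Summits.Ventures.CertifiedManyBodySolver.Downfold.StiffnessSeam
import Summits.Ventures.CertifiedManyBodySolver.Downfold.BoxesHg1201E
import Summits.Ventures.CertifiedManyBodySolver.Downfold.BoxesCCOC
import Summits.Ventures.CertifiedManyBodySolver.Downfold.BoxesNCCO
import Summits.Ventures.CertifiedManyBodySolver.Downfold.BoxesSLCO
import Summits.Ventures.CertifiedManyBodySolver.Certificates.HubbardSquare_HgE2LaE3BoxE_stiffness_kinematic
import Summits.Ventures.CertifiedManyBodySolver.Certificates.HubbardSquare_NiClBoxE_stiffness_kinematic
import Summits.Ventures.CertifiedManyBodySolver.Certificates.HubbardSquare_EdopedBoxE_stiffness_kinematic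
import HarnessLib

/-!
# Kinematic STIFFNESS words (ground-state, thermal, KT reading) typed on the cuprate object-E boxes of record
# `boxHg1201E_M19 / _M19b`, `boxCCOCE_M36 / _M58`, `boxNCCOE_M20v19`, `boxSLCOE_M37`

Venture CertifiedManyBodySolver, cell `pub/hubbard-downfold` (MO-S1 ↔ S3 seam; D-0150 L-DF2 «box ↦ one word»), seat
hubbard-downfold-unc-2 (`prover-hubbard-downfold-unc-2-g12-0`); companion of `Downfold/StiffnessSeam.lean` (La₂CuO₄ parent) and
`Downfold/BoxesLa214StiffnessKinematic.lean` (doped La-214). HONEST FRAMING: node-free one-body (kinematic) CEILINGS — every number is a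
kernel theorem of hubbard-tc p1's `Certificates/HubbardSquare_{HgE2LaE3,NiCl,Edoped}BoxE_stiffness_kinematic.lean`; a ceiling never speaks
to the presence of order; the KT reading `T_c ≤ (π/4)·c` is CONDITIONAL on the monotonicity-free dictionary `ThermalKTDictionaryAt` at the
point (2D single-layer MODEL, not a material `T_c`); a downfolded box is a systematic modelling claim. Boxes whose t′ entry is not inside a
kernel leaf's t′ range today (`boxHg1201E_M19P10`, `boxCCOCE_M57`, `boxNCCOE_M55v19/M56v19`, the YBCO / nickelate boxes) are NOT typed here.

| box | delivered cell (t′/t, n) | leaf | `c` | `T_c ≤` (KT, tree units) |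
|---|---|---|---|---|
| `boxHg1201E_M19` | [−0.54, −0.43] × [0.80, 0.88] | `hgBoxE2_opt` | 0.5188344 | 0.4074917 |
| `boxHg1201E_M19b` | [−0.54, −0.43] × [0.835, 0.915] | `hgBoxE2_ud` | 0.5272245 | 0.4140812 |
| `boxCCOCE_M36` | [−0.41, −0.30] × [0.88, 0.92] | `ccocBoxE_x010` | 0.4524628 | 0.3553635 |
| `boxCCOCE_M58` | [−0.41, −0.30] × [0.99, 1.01] | `ccocBoxE_parent` | 0.4768546 | 0.3745208 |
| `boxNCCOE_M20v19` | [−0.62, −0.51] × [1.09, 1.17] | `nccoBoxE_x015` | 0.6199998 | 0.4869468 |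
| `boxSLCOE_M37` | [−0.649, −0.548] × [1.09, 1.11] | `slcoBoxE_x010` | 0.6337868 | 0.4977751 |

References: T. Hazra, N. Verma, M. Randeria, PRX 9 (2019) 031049, eqs. (2)–(6) [HazraVermaRanderia2019]; A. Paramekanti, N. Trivedi,
M. Randeria, PRB 57 (1998) 11639, eq. (3), §IV [ParamekantiTrivediRanderia1998].
-/

noncomputable section

namespace Summit.Ventures.CertifiedManyBodySolver.Downfold

open Set NonemptyInterval
open Summit.Ventures.CertifiedManyBodySolver.Observables
open Summit.Ventures.CertifiedManyBodySolver.Certificates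

/-- Coordinates of a point of a delivered box `Set.Icc ![a, b, c] ![a', b', c']` (order `(U/t, t′/t, n)`). [folklore] -/
private theorem mem_s2Box_vec3E {a b c a' b' c' : ℝ} {θ : Fin 3 → ℝ}
    (hθ : θ ∈ Set.Icc (![a, b, c] : Fin 3 → ℝ) ![a', b', c']) :
    (a ≤ θ 0 ∧ θ 0 ≤ a') ∧ (b ≤ θ 1 ∧ θ 1 ≤ b') ∧ (c ≤ θ 2 ∧ θ 2 ≤ c') := by
  rw [Set.mem_Icc, Pi.le_def, Pi.le_def] at hθ
  obtain ⟨hlo, hhi⟩ := hθ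
  have h0 := hlo 0; have h1 := hlo 1; have h2 := hlo 2
  have h0' := hhi 0; have h1' := hhi 1; have h2' := hhi 2
  simp only [Matrix.cons_val_zero, Matrix.cons_val_one, Matrix.head_cons, Matrix.cons_val_two,
    Matrix.tail_cons] at h0 h1 h2 h0' h1' h2'
  exact ⟨⟨h0, h0'⟩, ⟨h1, h1'⟩, ⟨h2, h2'⟩⟩

/-! ### `boxHg1201E_M19` — HgBa₂CuO₄₊δ optimal (object E2: t′ ∈ [−0.54, −0.43], n ∈ [0.80, 0.88]) -/

/-- **Kinematic ground-state stiffness word on `boxHg1201E_M19`** (node-free): `ρ_s ≤ 5188344/10000000` at every point of the box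
(hubbard-tc p1's `hgBoxE2_opt_stiffnessSeqLeaf` on the delivered cell). [cite: HazraVermaRanderia2019, eqs. (2)-(6)] -/
theorem boxHg1201E_M19_stiffness_kinematic :
    HoldsOn (fun p : OneBandCoord → ℝ =>
      ObsStiffnessSeqCeilingAt (p .tpOverT) (p .UOverT) (p .filling) (5188344 / 10000000)) boxHg1201E_M19 := by
  refine holdsOn_of_forall_s2Box (B := boxHg1201E_M19) (eU := hg1201E_M19_U) (eS := hg1201E_M19_tp) (eN := hg1201E_M19_n) rfl rfl rfl
    (W := fun θ => ObsStiffnessSeqCeilingAt (θ 1) (θ 0) (θ 2) (5188344 / 10000000)) ?_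
  rw [hg1201E_M19_s2Lo, hg1201E_M19_s2Hi]
  intro θ hθ
  obtain ⟨-, htθ, hnθ⟩ := mem_s2Box_vec3E hθ
  exact hgBoxE2_opt_stiffnessSeqLeaf htθ (by linarith [hnθ.1]) (by linarith [hnθ.2])

/-- **Kinematic thermal stiffness word on `boxHg1201E_M19`** (every temperature): `ObsThermalStiffnessSeqCeilingAt … 5188344/10000000` at every point.
[cite: ParamekantiTrivediRanderia1998, eq. (3) and §IV] -/
theorem boxHg1201E_M19_thermalStiffness_kinematic :
    HoldsOn (fun p : OneBandCoord → ℝ =>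
      ObsThermalStiffnessSeqCeilingAt (p .tpOverT) (p .UOverT) (p .filling) (5188344 / 10000000)) boxHg1201E_M19 := by
  refine holdsOn_of_forall_s2Box (B := boxHg1201E_M19) (eU := hg1201E_M19_U) (eS := hg1201E_M19_tp) (eN := hg1201E_M19_n) rfl rfl rfl
    (W := fun θ => ObsThermalStiffnessSeqCeilingAt (θ 1) (θ 0) (θ 2) (5188344 / 10000000)) ?_
  rw [hg1201E_M19_s2Lo, hg1201E_M19_s2Hi]
  intro θ hθ
  obtain ⟨-, htθ, hnθ⟩ := mem_s2Box_vec3E hθ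
  exact hgBoxE2_opt_thermalStiffnessSeqLeaf htθ (by linarith [hnθ.1]) (by linarith [hnθ.2])

/-- **KT reading on `boxHg1201E_M19`** (CONDITIONAL on `ThermalKTDictionaryAt` at the point): `T_c ≤ 0.4074917` (tree units `t = 1`).
[cite: HazraVermaRanderia2019, eqs. (2)-(3) and App. G] -/
theorem boxHg1201E_M19_Tc_le_kinematic_KT :
    HoldsOn (fun p : OneBandCoord → ℝ => ∀ (ρe : ℝ → ℝ) (Tc : ℝ),
      ThermalKTDictionaryAt (p .tpOverT) (p .UOverT) (p .filling) ρe Tc → Tc ≤ 0.4074917) boxHg1201E_M19 := by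
  refine holdsOn_of_forall_s2Box (B := boxHg1201E_M19) (eU := hg1201E_M19_U) (eS := hg1201E_M19_tp) (eN := hg1201E_M19_n) rfl rfl rfl
    (W := fun θ => ∀ (ρe : ℝ → ℝ) (Tc : ℝ), ThermalKTDictionaryAt (θ 1) (θ 0) (θ 2) ρe Tc → Tc ≤ 0.4074917) ?_
  rw [hg1201E_M19_s2Lo, hg1201E_M19_s2Hi]
  intro θ hθ ρe Tc hKT
  obtain ⟨-, htθ, hnθ⟩ := mem_s2Box_vec3E hθ
  exact Summit.Ventures.CertifiedManyBodySolver.Certificates.ThermalKTDictionaryAt.hgBoxE2_opt_le_decimal htθ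
    (by linarith [hnθ.1]) (by linarith [hnθ.2]) hKT

/-! ### `boxHg1201E_M19b` — HgBa₂CuO₄₊δ underdoped (n ∈ [0.835, 0.915]) -/

/-- **Kinematic ground-state stiffness word on `boxHg1201E_M19b`** (node-free): `ρ_s ≤ 5272245/10000000` at every point of the box
(hubbard-tc p1's `hgBoxE2_ud_stiffnessSeqLeaf` on the delivered cell). [cite: HazraVermaRanderia2019, eqs. (2)-(6)] -/
theorem boxHg1201E_M19b_stiffness_kinematic :
    HoldsOn (fun p : OneBandCoord → ℝ =>
      ObsStiffnessSeqCeilingAt (p .tpOverT) (p .UOverT) (p .filling) (5272245 / 10000000)) boxHg1201E_M19b := by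
  refine holdsOn_of_forall_s2Box (B := boxHg1201E_M19b) (eU := hg1201E_M19b_U) (eS := hg1201E_M19b_tp) (eN := hg1201E_M19b_n) rfl rfl rfl
    (W := fun θ => ObsStiffnessSeqCeilingAt (θ 1) (θ 0) (θ 2) (5272245 / 10000000)) ?_
  rw [hg1201E_M19b_s2Lo, hg1201E_M19b_s2Hi]
  intro θ hθ
  obtain ⟨-, htθ, hnθ⟩ := mem_s2Box_vec3E hθ
  exact hgBoxE2_ud_stiffnessSeqLeaf htθ (by linarith [hnθ.1]) (by linarith [hnθ.2])

/-- **Kinematic thermal stiffness word on `boxHg1201E_M19b`** (every temperature): `ObsThermalStiffnessSeqCeilingAt … 5272245/10000000` at every point.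
[cite: ParamekantiTrivediRanderia1998, eq. (3) and §IV] -/
theorem boxHg1201E_M19b_thermalStiffness_kinematic :
    HoldsOn (fun p : OneBandCoord → ℝ =>
      ObsThermalStiffnessSeqCeilingAt (p .tpOverT) (p .UOverT) (p .filling) (5272245 / 10000000)) boxHg1201E_M19b := by
  refine holdsOn_of_forall_s2Box (B := boxHg1201E_M19b) (eU := hg1201E_M19b_U) (eS := hg1201E_M19b_tp) (eN := hg1201E_M19b_n) rfl rfl rfl
    (W := fun θ => ObsThermalStiffnessSeqCeilingAt (θ 1) (θ 0) (θ 2) (5272245 / 10000000)) ?_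
  rw [hg1201E_M19b_s2Lo, hg1201E_M19b_s2Hi]
  intro θ hθ
  obtain ⟨-, htθ, hnθ⟩ := mem_s2Box_vec3E hθ
  exact hgBoxE2_ud_thermalStiffnessSeqLeaf htθ (by linarith [hnθ.1]) (by linarith [hnθ.2])

/-- **KT reading on `boxHg1201E_M19b`** (CONDITIONAL on `ThermalKTDictionaryAt` at the point): `T_c ≤ 0.4140812` (tree units `t = 1`).
[cite: HazraVermaRanderia2019, eqs. (2)-(3) and App. G] -/
theorem boxHg1201E_M19b_Tc_le_kinematic_KT :
    HoldsOn (fun p : OneBandCoord → ℝ => ∀ (ρe : ℝ → ℝ) (Tc : ℝ),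
      ThermalKTDictionaryAt (p .tpOverT) (p .UOverT) (p .filling) ρe Tc → Tc ≤ 0.4140812) boxHg1201E_M19b := by
  refine holdsOn_of_forall_s2Box (B := boxHg1201E_M19b) (eU := hg1201E_M19b_U) (eS := hg1201E_M19b_tp) (eN := hg1201E_M19b_n) rfl rfl rfl
    (W := fun θ => ∀ (ρe : ℝ → ℝ) (Tc : ℝ), ThermalKTDictionaryAt (θ 1) (θ 0) (θ 2) ρe Tc → Tc ≤ 0.4140812) ?_
  rw [hg1201E_M19b_s2Lo, hg1201E_M19b_s2Hi]
  intro θ hθ ρe Tc hKT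
  obtain ⟨-, htθ, hnθ⟩ := mem_s2Box_vec3E hθ
  exact Summit.Ventures.CertifiedManyBodySolver.Certificates.ThermalKTDictionaryAt.hgBoxE2_ud_le_decimal htθ
    (by linarith [hnθ.1]) (by linarith [hnθ.2]) hKT

/-! ### `boxCCOCE_M36` — Ca₂₋ₓNaₓCuO₂Cl₂ x = 0.10 (t′ ∈ [−0.41, −0.30], n ∈ [0.88, 0.92]) -/

/-- **Kinematic ground-state stiffness word on `boxCCOCE_M36`** (node-free): `ρ_s ≤ 4524628/10000000` at every point of the box
(hubbard-tc p1's `ccocBoxE_x010_stiffnessSeqLeaf` on the delivered cell). [cite: HazraVermaRanderia2019, eqs. (2)-(6)] -/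
theorem boxCCOCE_M36_stiffness_kinematic :
    HoldsOn (fun p : OneBandCoord → ℝ =>
      ObsStiffnessSeqCeilingAt (p .tpOverT) (p .UOverT) (p .filling) (4524628 / 10000000)) boxCCOCE_M36 := by
  refine holdsOn_of_forall_s2Box (B := boxCCOCE_M36) (eU := cCOCE_M36_U) (eS := cCOCE_M36_tp) (eN := cCOCE_M36_n) rfl rfl rfl
    (W := fun θ => ObsStiffnessSeqCeilingAt (θ 1) (θ 0) (θ 2) (4524628 / 10000000)) ?_
  rw [cCOCE_M36_s2Lo, cCOCE_M36_s2Hi]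
  intro θ hθ
  obtain ⟨-, htθ, hnθ⟩ := mem_s2Box_vec3E hθ
  exact ccocBoxE_x010_stiffnessSeqLeaf htθ (by linarith [hnθ.1]) (by linarith [hnθ.2])

/-- **Kinematic thermal stiffness word on `boxCCOCE_M36`** (every temperature): `ObsThermalStiffnessSeqCeilingAt … 4524628/10000000` at every point.
[cite: ParamekantiTrivediRanderia1998, eq. (3) and §IV] -/
theorem boxCCOCE_M36_thermalStiffness_kinematic :
    HoldsOn (fun p : OneBandCoord → ℝ =>
      ObsThermalStiffnessSeqCeilingAt (p .tpOverT) (p .UOverT) (p .filling) (4524628 / 10000000)) boxCCOCE_M36 := by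
  refine holdsOn_of_forall_s2Box (B := boxCCOCE_M36) (eU := cCOCE_M36_U) (eS := cCOCE_M36_tp) (eN := cCOCE_M36_n) rfl rfl rfl
    (W := fun θ => ObsThermalStiffnessSeqCeilingAt (θ 1) (θ 0) (θ 2) (4524628 / 10000000)) ?_
  rw [cCOCE_M36_s2Lo, cCOCE_M36_s2Hi]
  intro θ hθ
  obtain ⟨-, htθ, hnθ⟩ := mem_s2Box_vec3E hθ
  exact ccocBoxE_x010_thermalStiffnessSeqLeaf htθ (by linarith [hnθ.1]) (by linarith [hnθ.2])

/-- **KT reading on `boxCCOCE_M36`** (CONDITIONAL on `ThermalKTDictionaryAt` at the point): `T_c ≤ 0.3553635` (tree units `t = 1`).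
[cite: HazraVermaRanderia2019, eqs. (2)-(3) and App. G] -/
theorem boxCCOCE_M36_Tc_le_kinematic_KT :
    HoldsOn (fun p : OneBandCoord → ℝ => ∀ (ρe : ℝ → ℝ) (Tc : ℝ),
      ThermalKTDictionaryAt (p .tpOverT) (p .UOverT) (p .filling) ρe Tc → Tc ≤ 0.3553635) boxCCOCE_M36 := by
  refine holdsOn_of_forall_s2Box (B := boxCCOCE_M36) (eU := cCOCE_M36_U) (eS := cCOCE_M36_tp) (eN := cCOCE_M36_n) rfl rfl rfl
    (W := fun θ => ∀ (ρe : ℝ → ℝ) (Tc : ℝ), ThermalKTDictionaryAt (θ 1) (θ 0) (θ 2) ρe Tc → Tc ≤ 0.3553635) ?_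
  rw [cCOCE_M36_s2Lo, cCOCE_M36_s2Hi]
  intro θ hθ ρe Tc hKT
  obtain ⟨-, htθ, hnθ⟩ := mem_s2Box_vec3E hθ
  exact Summit.Ventures.CertifiedManyBodySolver.Certificates.ThermalKTDictionaryAt.ccocBoxE_x010_le_decimal htθ
    (by linarith [hnθ.1]) (by linarith [hnθ.2]) hKT

/-! ### `boxCCOCE_M58` — Ca₂CuO₂Cl₂ parent (n ∈ [0.99, 1.01]) -/

/-- **Kinematic ground-state stiffness word on `boxCCOCE_M58`** (node-free): `ρ_s ≤ 4768546/10000000` at every point of the box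
(hubbard-tc p1's `ccocBoxE_parent_stiffnessSeqLeaf` on the delivered cell). [cite: HazraVermaRanderia2019, eqs. (2)-(6)] -/
theorem boxCCOCE_M58_stiffness_kinematic :
    HoldsOn (fun p : OneBandCoord → ℝ =>
      ObsStiffnessSeqCeilingAt (p .tpOverT) (p .UOverT) (p .filling) (4768546 / 10000000)) boxCCOCE_M58 := by
  refine holdsOn_of_forall_s2Box (B := boxCCOCE_M58) (eU := cCOCE_M58_U) (eS := cCOCE_M58_tp) (eN := cCOCE_M58_n) rfl rfl rfl
    (W := fun θ => ObsStiffnessSeqCeilingAt (θ 1) (θ 0) (θ 2) (4768546 / 10000000)) ?_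
  rw [cCOCE_M58_s2Lo, cCOCE_M58_s2Hi]
  intro θ hθ
  obtain ⟨-, htθ, hnθ⟩ := mem_s2Box_vec3E hθ
  exact ccocBoxE_parent_stiffnessSeqLeaf htθ (by linarith [hnθ.1]) (by linarith [hnθ.2])

/-- **Kinematic thermal stiffness word on `boxCCOCE_M58`** (every temperature): `ObsThermalStiffnessSeqCeilingAt … 4768546/10000000` at every point.
[cite: ParamekantiTrivediRanderia1998, eq. (3) and §IV] -/
theorem boxCCOCE_M58_thermalStiffness_kinematic :
    HoldsOn (fun p : OneBandCoord → ℝ =>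
      ObsThermalStiffnessSeqCeilingAt (p .tpOverT) (p .UOverT) (p .filling) (4768546 / 10000000)) boxCCOCE_M58 := by
  refine holdsOn_of_forall_s2Box (B := boxCCOCE_M58) (eU := cCOCE_M58_U) (eS := cCOCE_M58_tp) (eN := cCOCE_M58_n) rfl rfl rfl
    (W := fun θ => ObsThermalStiffnessSeqCeilingAt (θ 1) (θ 0) (θ 2) (4768546 / 10000000)) ?_
  rw [cCOCE_M58_s2Lo, cCOCE_M58_s2Hi]
  intro θ hθ
  obtain ⟨-, htθ, hnθ⟩ := mem_s2Box_vec3E hθ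
  exact ccocBoxE_parent_thermalStiffnessSeqLeaf htθ (by linarith [hnθ.1]) (by linarith [hnθ.2])

/-- **KT reading on `boxCCOCE_M58`** (CONDITIONAL on `ThermalKTDictionaryAt` at the point): `T_c ≤ 0.3745208` (tree units `t = 1`).
[cite: HazraVermaRanderia2019, eqs. (2)-(3) and App. G] -/
theorem boxCCOCE_M58_Tc_le_kinematic_KT :
    HoldsOn (fun p : OneBandCoord → ℝ => ∀ (ρe : ℝ → ℝ) (Tc : ℝ),
      ThermalKTDictionaryAt (p .tpOverT) (p .UOverT) (p .filling) ρe Tc → Tc ≤ 0.3745208) boxCCOCE_M58 := by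
  refine holdsOn_of_forall_s2Box (B := boxCCOCE_M58) (eU := cCOCE_M58_U) (eS := cCOCE_M58_tp) (eN := cCOCE_M58_n) rfl rfl rfl
    (W := fun θ => ∀ (ρe : ℝ → ℝ) (Tc : ℝ), ThermalKTDictionaryAt (θ 1) (θ 0) (θ 2) ρe Tc → Tc ≤ 0.3745208) ?_
  rw [cCOCE_M58_s2Lo, cCOCE_M58_s2Hi]
  intro θ hθ ρe Tc hKT
  obtain ⟨-, htθ, hnθ⟩ := mem_s2Box_vec3E hθ
  exact Summit.Ventures.CertifiedManyBodySolver.Certificates.ThermalKTDictionaryAt.ccocBoxE_parent_le_decimal htθ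
    (by linarith [hnθ.1]) (by linarith [hnθ.2]) hKT

/-! ### `boxNCCOE_M20v19` — Nd₂₋ₓCeₓCuO₄ x = 0.15 (electron-doped; t′ ∈ [−0.62, −0.51], n ∈ [1.09, 1.17]) -/

/-- **Kinematic ground-state stiffness word on `boxNCCOE_M20v19`** (node-free): `ρ_s ≤ 6199998/10000000` at every point of the box
(hubbard-tc p1's `nccoBoxE_x015_stiffnessSeqLeaf` on the delivered cell). [cite: HazraVermaRanderia2019, eqs. (2)-(6)] -/
theorem boxNCCOE_M20v19_stiffness_kinematic :
    HoldsOn (fun p : OneBandCoord → ℝ =>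
      ObsStiffnessSeqCeilingAt (p .tpOverT) (p .UOverT) (p .filling) (6199998 / 10000000)) boxNCCOE_M20v19 := by
  refine holdsOn_of_forall_s2Box (B := boxNCCOE_M20v19) (eU := nCCOE_M20v19_U) (eS := nCCOE_M20v19_tp) (eN := nCCOE_M20v19_n) rfl rfl rfl
    (W := fun θ => ObsStiffnessSeqCeilingAt (θ 1) (θ 0) (θ 2) (6199998 / 10000000)) ?_
  rw [nCCOE_M20v19_s2Lo, nCCOE_M20v19_s2Hi]
  intro θ hθ
  obtain ⟨-, htθ, hnθ⟩ := mem_s2Box_vec3E hθ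
  exact nccoBoxE_x015_stiffnessSeqLeaf htθ (by linarith [hnθ.1]) (by linarith [hnθ.2])

/-- **Kinematic thermal stiffness word on `boxNCCOE_M20v19`** (every temperature): `ObsThermalStiffnessSeqCeilingAt … 6199998/10000000` at every point.
[cite: ParamekantiTrivediRanderia1998, eq. (3) and §IV] -/
theorem boxNCCOE_M20v19_thermalStiffness_kinematic :
    HoldsOn (fun p : OneBandCoord → ℝ =>
      ObsThermalStiffnessSeqCeilingAt (p .tpOverT) (p .UOverT) (p .filling) (6199998 / 10000000)) boxNCCOE_M20v19 := by
  refine holdsOn_of_forall_s2Box (B := boxNCCOE_M20v19) (eU := nCCOE_M20v19_U) (eS := nCCOE_M20v19_tp) (eN := nCCOE_M20v19_n) rfl rfl rfl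
    (W := fun θ => ObsThermalStiffnessSeqCeilingAt (θ 1) (θ 0) (θ 2) (6199998 / 10000000)) ?_
  rw [nCCOE_M20v19_s2Lo, nCCOE_M20v19_s2Hi]
  intro θ hθ
  obtain ⟨-, htθ, hnθ⟩ := mem_s2Box_vec3E hθ
  exact nccoBoxE_x015_thermalStiffnessSeqLeaf htθ (by linarith [hnθ.1]) (by linarith [hnθ.2])

/-- **KT reading on `boxNCCOE_M20v19`** (CONDITIONAL on `ThermalKTDictionaryAt` at the point): `T_c ≤ 0.4869468` (tree units `t = 1`).
[cite: HazraVermaRanderia2019, eqs. (2)-(3) and App. G] -/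
theorem boxNCCOE_M20v19_Tc_le_kinematic_KT :
    HoldsOn (fun p : OneBandCoord → ℝ => ∀ (ρe : ℝ → ℝ) (Tc : ℝ),
      ThermalKTDictionaryAt (p .tpOverT) (p .UOverT) (p .filling) ρe Tc → Tc ≤ 0.4869468) boxNCCOE_M20v19 := by
  refine holdsOn_of_forall_s2Box (B := boxNCCOE_M20v19) (eU := nCCOE_M20v19_U) (eS := nCCOE_M20v19_tp) (eN := nCCOE_M20v19_n) rfl rfl rfl
    (W := fun θ => ∀ (ρe : ℝ → ℝ) (Tc : ℝ), ThermalKTDictionaryAt (θ 1) (θ 0) (θ 2) ρe Tc → Tc ≤ 0.4869468) ?_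
  rw [nCCOE_M20v19_s2Lo, nCCOE_M20v19_s2Hi]
  intro θ hθ ρe Tc hKT
  obtain ⟨-, htθ, hnθ⟩ := mem_s2Box_vec3E hθ
  exact Summit.Ventures.CertifiedManyBodySolver.Certificates.ThermalKTDictionaryAt.nccoBoxE_x015_le_decimal htθ
    (by linarith [hnθ.1]) (by linarith [hnθ.2]) hKT

/-! ### `boxSLCOE_M37` — Sr₁₋ₓLaₓCuO₂ x = 0.10 (electron-doped; t′ ∈ [−0.649, −0.548], n ∈ [1.09, 1.11]) -/

/-- **Kinematic ground-state stiffness word on `boxSLCOE_M37`** (node-free): `ρ_s ≤ 6337868/10000000` at every point of the box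
(hubbard-tc p1's `slcoBoxE_x010_stiffnessSeqLeaf` on the delivered cell). [cite: HazraVermaRanderia2019, eqs. (2)-(6)] -/
theorem boxSLCOE_M37_stiffness_kinematic :
    HoldsOn (fun p : OneBandCoord → ℝ =>
      ObsStiffnessSeqCeilingAt (p .tpOverT) (p .UOverT) (p .filling) (6337868 / 10000000)) boxSLCOE_M37 := by
  refine holdsOn_of_forall_s2Box (B := boxSLCOE_M37) (eU := sLCOE_M37_U) (eS := sLCOE_M37_tp) (eN := sLCOE_M37_n) rfl rfl rfl
    (W := fun θ => ObsStiffnessSeqCeilingAt (θ 1) (θ 0) (θ 2) (6337868 / 10000000)) ?_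
  rw [sLCOE_M37_s2Lo, sLCOE_M37_s2Hi]
  intro θ hθ
  obtain ⟨-, htθ, hnθ⟩ := mem_s2Box_vec3E hθ
  exact slcoBoxE_x010_stiffnessSeqLeaf htθ (by linarith [hnθ.1]) (by linarith [hnθ.2])

/-- **Kinematic thermal stiffness word on `boxSLCOE_M37`** (every temperature): `ObsThermalStiffnessSeqCeilingAt … 6337868/10000000` at every point.
[cite: ParamekantiTrivediRanderia1998, eq. (3) and §IV] -/
theorem boxSLCOE_M37_thermalStiffness_kinematic :
    HoldsOn (fun p : OneBandCoord → ℝ =>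
      ObsThermalStiffnessSeqCeilingAt (p .tpOverT) (p .UOverT) (p .filling) (6337868 / 10000000)) boxSLCOE_M37 := by
  refine holdsOn_of_forall_s2Box (B := boxSLCOE_M37) (eU := sLCOE_M37_U) (eS := sLCOE_M37_tp) (eN := sLCOE_M37_n) rfl rfl rfl
    (W := fun θ => ObsThermalStiffnessSeqCeilingAt (θ 1) (θ 0) (θ 2) (6337868 / 10000000)) ?_
  rw [sLCOE_M37_s2Lo, sLCOE_M37_s2Hi]
  intro θ hθ
  obtain ⟨-, htθ, hnθ⟩ := mem_s2Box_vec3E hθ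
  exact slcoBoxE_x010_thermalStiffnessSeqLeaf htθ (by linarith [hnθ.1]) (by linarith [hnθ.2])

/-- **KT reading on `boxSLCOE_M37`** (CONDITIONAL on `ThermalKTDictionaryAt` at the point): `T_c ≤ 0.4977751` (tree units `t = 1`).
[cite: HazraVermaRanderia2019, eqs. (2)-(3) and App. G] -/
theorem boxSLCOE_M37_Tc_le_kinematic_KT :
    HoldsOn (fun p : OneBandCoord → ℝ => ∀ (ρe : ℝ → ℝ) (Tc : ℝ),
      ThermalKTDictionaryAt (p .tpOverT) (p .UOverT) (p .filling) ρe Tc → Tc ≤ 0.4977751) boxSLCOE_M37 := by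
  refine holdsOn_of_forall_s2Box (B := boxSLCOE_M37) (eU := sLCOE_M37_U) (eS := sLCOE_M37_tp) (eN := sLCOE_M37_n) rfl rfl rfl
    (W := fun θ => ∀ (ρe : ℝ → ℝ) (Tc : ℝ), ThermalKTDictionaryAt (θ 1) (θ 0) (θ 2) ρe Tc → Tc ≤ 0.4977751) ?_
  rw [sLCOE_M37_s2Lo, sLCOE_M37_s2Hi]
  intro θ hθ ρe Tc hKT
  obtain ⟨-, htθ, hnθ⟩ := mem_s2Box_vec3E hθ
  exact Summit.Ventures.CertifiedManyBodySolver.Certificates.ThermalKTDictionaryAt.slcoBoxE_x010_le_decimal htθ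
    (by linarith [hnθ.1]) (by linarith [hnθ.2]) hKT

end Summit.Ventures.CertifiedManyBodySolver.Downfold

end
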